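import Summits.Schanuel.Schanuel.Theorems.RootDecomp1KHeightGrading02

/-!
# RootDecomp1KHeightGrading — lens 1, generation 52, NODE 12 «THE HEIGHT GRADING: the thin-fibre clause graded by (deg_Y P, xdeg P) via the height transfer along the curve» (RULE K-R42 (P4)/(P2), K-R43) — continuation (RootDecomp1KHeightGrading03): §6 the costume test for H17P, the boundary member B17P and the non-member N2P

(lens-1 g52 NODE 12 HOME kernel K = HOME/decomp-schanuel-lens-1/g52/HeightGrading.lean d2c43eec…, 936 l, 89 thm + 14 def, imports tree …RootDecomp1KSubspaceBranch04 + Mathlib FieldTheory.IsAlgClosed.AlgebraicClosure, RingTheory.Polynomial.Eisenstein.Basic, NumberTheory.Height.NumberField ONLY; Probe HeightGradingProbe.lean rc 0 (116 axiom guards) / Ctrl0 rc 0 / Ctrl rc 1 = 22 planted; memo NODE-g52b.md with the DERIVATION MEMO (d1)–(d6); SHA256SUMS (25 entries); cite-kind ledger item wi-102467 (Lang 1983 Ch. 4 Cor. 3.5, curve case → consumption shape HeightComparison); CLAIM L2556, crit EX-ANTE PRICE L2560 (ONE THEOREM ×1 under RULE K-R42 (P4) iff CHECKLIST K-g52b;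 binder = the ε-form ONLY, label (β) paper corollary with derivation memo; RULES K-R43, K-R42 (vii′)), NODE L2563 / REQUEST L2564, census STAGING NOTE 2 L2565, critic VERDICT L2566: CLEARED — THEOREM ×1 under RULE K-R42 (P4), CHECKLIST K-g52b met, binder grade (β) under K-R43 with derivation memo (d1)–(d6); PORT GO (credit port, verbatim; MODs = docstrings + the one privatisation); lens-1 tally ×14 + THEOREM ×11. Port by census-1 gen 22 as `RootDecomp1KHeightGrading01–03` (`--supports stmt-Schanuel-33364`; no census credit): 01 = §0 `logHt` (= Mathlib's `Height.logHeight₁` on ℚ, `logHt_eq_logHeight₁`), `GeomIrreducible P` (irreducible over `AlgebraicClosure ℚ`), the ONE new input typed by name **`HeightComparison : Prop`** ([hypothesis] definition — the ε-form of the height comparison `|xdeg P · h(x) − deg_Y P · h(y)| ≤ ε·h(x) + c` on the rational points of a geometrically irreducible plane curve; sources in the docstring: Lang 1983 Ch. 4 Cor. 3.5, Bombieri–Gubler, Hindry–Silverman B.5.9, Serre; a THEOREM in print, NOT proved in the tree), `BddLevelEmpty` + §1 heights of rationals and of `x_N` + §2 the two asymptotic inequalities (real arithmetic); 02 = §3 THEOREM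 A **`thinFibreAt_of_heightComparison (hH) (hgi : GeomIrreducible P) (hk : 1 ≤ xdeg P) (hlt : P.natDegree < m₀ * xdeg P) : ThinFibreAt m₀ P`** + §4 THEOREM B **`thinFibreAt_iff_bddLevelEmpty_of_heightComparison`** (strict side `m₀ * xdeg P < P.natDegree`; `thinFibreAt_of_bddLevelEmpty` hyp-free) + §5 residual RE-GRADED (`HeightDecidedAt`, `HeightOffAt`, `HeightOnlyOffAt`, `thinFibre_of_padicSubspace_heightComparison`, `heightOffAt_of_offSbAt`; bookkeeping ×0) + §6 (first half) the member `H17P` = x³(Y²−17)² + x²Y + x(Y+1) + Y⁵ with `geomIrreducible_H17P` (Eisenstein at (x)) and `thinFibreAt_two_H17P`; 03 = §6 (second half) the COSTUME TEST BY NAME (`not_decidedAt_two_H17P`, `not_sepTopAt_H17P`, `thinThreshold_H17P`, …) + the boundary member `B17P` = Y² − 17x and the norm-form non-member `N2P` = Y² − 2x² (`not_geomIrreducible_N2P`). PORT EDITS: the generic one-liner `half_lt_log_two` PRIVATISED (dry-run dedup.foreign note: prints like `Summit.Parity.….log_two_gt_half` of another summit; used only inside §2); 27 one-line docstrings added on undocumented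 computation lemmas / member defs (statements quoted); `xdeg` is the TREE's `RootDecomp1KDegreeLadder.xdeg` (no re-declaration); K has no private decls, no set_option, no «[cite» token; the one `example` (xdeg of an x-linear presentation) kept; statements and proofs otherwise VERBATIM. Rung 0 — nothing here proves Schanuel, 33364, 33363, 31077 or ThinFibre 2; everything is CONDITIONAL on `HeightComparison` (and §5 also on `PadicSubspace`).)
-/

noncomputable section

namespace Summit.Schanuel.Schanuel.Theorems.RootDecomp1KHeightGrading

open Polynomial LiouvilleNumber
open scoped Nat
open Summit.Schanuel.Schanuel.Theorems.RootDecomp1KSkelCell (SkelLiouvilleFix)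
open Summit.Schanuel.Schanuel.Theorems.RootDecomp1KTwoBaseCell (psNumer partialSum_eq_psNumer_div coprime_psNumer
  partialSum_pos' partialSum_lt_two)
open Summit.Schanuel.Schanuel.Theorems.RootDecomp1KDegreeLadder
open Summit.Schanuel.Schanuel.Theorems.RootDecomp1KXLinearCore
open Summit.Schanuel.Schanuel.Theorems.RootDecomp1KXLinear
open Summit.Schanuel.Schanuel.Theorems.RootDecomp1KXLinearII
open Summit.Schanuel.Schanuel.Theorems.RootDecomp1KXTop
open Summit.Schanuel.Schanuel.Theorems.RootDecomp1KXAll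
open Summit.Schanuel.Schanuel.Theorems.RootDecomp1KLevelFinite
open Summit.Schanuel.Schanuel.Theorems.RootDecomp1KSubspaceBranch

/-! #### The costume test: `H17P` is in NO tree class decided at `m₀ = 2` and NOT in node 11's subspace class -/

/-- `¬ H17P.natDegree < 2` (the degree-ladder disjunct fails: `deg_Y = 5`). -/
theorem not_natDegree_H17P_lt_two : ¬ H17P.natDegree < 2 := by rw [natDegree_H17P]; norm_num

/-- `H17P` has NO x-linear presentation (`x`-degree `3`). -/
theorem H17P_ne_xLinP (A B : ℤ[X]) : H17P ≠ xLinP A B := by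
  intro hP
  have h := fun x : ℝ => congrArg (fun Q => bev Q x 0) hP
  simp only [bev_H17P, bev_xLinP] at h
  have h0 := h 0
  have h1 := h 1
  have h2 := h 2
  norm_num at h0 h1 h2
  linarith

/-- `¬ XLinearLt H17P`. -/
theorem not_xLinearLt_H17P : ¬ XLinearLt H17P := fun ⟨A, B, _, _, hP⟩ => H17P_ne_xLinP A B hP

/-- the separable x-linear disjunct of `DecidedAt 2` fails already at `3 ≤ 2`. -/
theorem not_xLinear_sep_H17P :
    ¬ (3 ≤ 2 ∧ ∃ A B : ℤ[X], (B.map (Int.castRingHom ℚ)).Separable ∧ H17P = xLinP A B) := fun h => by omega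

/-- `(Y² − 17)²` HAS a (double) root in `ℚ₂` (`√17 ∈ ℤ₂`, tree `exists_padic_root_m17C_two`). -/
theorem exists_padic_root_h17C_three : ∃ z : ℚ_[2], aeval z (h17C 3) = 0 := by
  obtain ⟨z, hz⟩ := exists_padic_root_m17C_two
  exact ⟨z, by rw [h17C_three_eq_sq, map_pow, hz, zero_pow two_ne_zero]⟩

/-- in EVERY presentation `H17P = Σ_{j ≤ k} x^j c_j(Y)` the top `x`-coefficient has a root in `ℚ₂` (it is `(Y² − 17)²`
or `0`). -/
theorem exists_padic_root_top_of_H17P_eq (k : ℕ) (c : ℕ → ℤ[X]) (h : H17P = xPolyP k c) :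
    ∃ z : ℚ_[2], aeval z (c k) = 0 := by
  have hc : ∀ i j : ℕ, (if j ∈ Finset.range 4 then (h17C j).coeff i else 0) =
      (if j ∈ Finset.range (k + 1) then (c j).coeff i else 0) := by
    intro i j
    rw [← coeff_coeff_xPolyP, ← coeff_coeff_xPolyP, ← h]; rfl
  rcases lt_trichotomy k 3 with hk | rfl | hk
  · exfalso
    have h33 := hc 0 3
    rw [if_pos (by simp), if_neg (by simp; omega), h17C_three, coeff_zero_eq_eval_zero] at h33
    norm_num [map_ofNat] at h33
  · have hc3 : c 3 = h17C 3 := by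
      ext i
      have := hc i 3
      rw [if_pos (by simp), if_pos (by simp)] at this
      exact this.symm
    rw [hc3]
    exact exists_padic_root_h17C_three
  · refine ⟨0, ?_⟩
    have hck : c k = 0 := by
      ext i
      have := hc i k
      rw [if_neg (by simp; omega), if_pos (by simp)] at this
      rw [coeff_zero]; exact this.symm
    rw [hck, map_zero]

/-- `¬ RootlessTop e H17P` for every `e`. -/
theorem not_rootlessTop_H17P (e : ℕ) : ¬ RootlessTop e H17P := by
  rintro ⟨k, c, _, hroot, hP⟩
  obtain ⟨z, hz⟩ := exists_padic_root_top_of_H17P_eq k c hP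
  exact hroot z hz

/-- every root of `(Y² − 17)²` in `ℂ₂` has multiplicity `≤ 2` … -/
theorem rootMultiplicity_h17C_three_le (β : PadicAlgCl 2) :
    rootMultiplicity β ((h17C 3).map (algebraMap ℤ (PadicAlgCl 2))) ≤ 2 := by
  have hmo : (m17C 2).Monic := by rw [m17C_two]; exact monic_X_pow_sub_C _ two_ne_zero
  have hne : (m17C 2).map (algebraMap ℤ (PadicAlgCl 2)) ≠ 0 := (hmo.map _).ne_zero
  rw [h17C_three_eq_sq, Polynomial.map_pow, pow_two, rootMultiplicity_mul (mul_ne_zero hne hne)]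
  have := rootMultiplicity_le_one_of_separable (m17C 2) separable_m17C_two β
  omega

/-- … and `√17 ∈ ℂ₂` has multiplicity exactly `≥ 2`: so `muTop H17P = 2`. -/
theorem muTop_H17P : muTop H17P = 2 := by
  refine le_antisymm (muTop_xPolyP_le 3 h17C 2 h17C_three_ne_zero rootMultiplicity_h17C_three_le) ?_
  have hmo : (m17C 2).Monic := by rw [m17C_two]; exact monic_X_pow_sub_C _ two_ne_zero
  have hne : (m17C 2).map (algebraMap ℤ (PadicAlgCl 2)) ≠ 0 := (hmo.map _).ne_zero
  have hdeg : ((m17C 2).map (algebraMap ℤ (PadicAlgCl 2))).degree ≠ 0 := by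
    rw [m17C_two, Polynomial.map_sub, Polynomial.map_pow, map_X, map_C, degree_X_pow_sub_C (by norm_num)]
    norm_num
  obtain ⟨β, hβ⟩ := IsAlgClosed.exists_root _ hdeg
  have h1 : 1 ≤ rootMultiplicity β ((m17C 2).map (algebraMap ℤ (PadicAlgCl 2))) :=
    (rootMultiplicity_pos hne).mpr hβ
  have h2 : 2 ≤ rootMultiplicity β ((topX H17P).map (algebraMap ℤ (PadicAlgCl 2))) := by
    rw [topX_H17P, h17C_three_eq_sq, Polynomial.map_pow, pow_two, rootMultiplicity_mul (mul_ne_zero hne hne)]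
    omega
  exact h2.trans (rootMultiplicity_le_muTop H17P β)

/-- `eTop H17P = 1` (`deg_Y − deg c₃ = 5 − 4`). -/
theorem eTop_H17P : eTop H17P = 1 := by
  rw [eTop, topX_H17P, natDegree_H17P, natDegree_h17C_three]

/-- **the tree's threshold EVALUATED: `thinThreshold H17P = 5`** — `thinFibreAt_all` reaches `H17P` only at
`m₀ ≥ 5`; THEOREM A reaches it at `m₀ = 2`. -/
theorem thinThreshold_H17P : thinThreshold H17P = 5 := by
  rw [thinThreshold, muTop_H17P, eTop_H17P]; omega

/-- `¬ thinThreshold H17P ≤ 2` (indeed `¬ ≤ 4`). -/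
theorem not_thinThreshold_H17P_le_two : ¬ thinThreshold H17P ≤ 2 := by rw [thinThreshold_H17P]; norm_num

/-- **`H17P` is in NO class decided at `m₀ = 2`** (each disjunct of `DecidedAt 2` refuted by name). -/
theorem not_decidedAt_two_H17P : ¬ DecidedAt 2 H17P := by
  rintro (h | h | h | h | h)
  · exact not_natDegree_H17P_lt_two h
  · exact not_xLinearLt_H17P h
  · exact not_xLinear_sep_H17P h
  · exact not_thinThreshold_H17P_le_two h
  · exact not_rootlessTop_H17P 1 h

/-- the top `(Y² − 17)²` is NOT separable over `ℚ` … -/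
theorem not_separable_topX_H17P : ¬ ((topX H17P).map (Int.castRingHom ℚ)).Separable := by
  rw [topX_H17P, h17C_three_eq_sq, Polynomial.map_pow]
  intro hsep
  have hnu : ¬ IsUnit ((m17C 2).map (Int.castRingHom ℚ)) := by
    intro hu
    have h0 := natDegree_eq_zero_of_isUnit hu
    rw [m17C_two, Polynomial.map_sub, Polynomial.map_pow, map_X, map_C, natDegree_X_pow_sub_C] at h0
    exact absurd h0 (by norm_num)
  have := (hsep.of_pow hnu two_ne_zero).2
  norm_num at this

/-- … so **`H17P` is NOT in node 11's subspace class `SepTopAt m₀`, at ANY `m₀`**. -/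
theorem not_sepTopAt_H17P (m₀ : ℕ) : ¬ SepTopAt m₀ H17P := fun h => not_separable_topX_H17P h.1

/-- **COSTUME TEST BY NAME, summarised**: `H17P` lies in the open territory of record after node 11
(`¬ DecidedAt 2 ∧ ¬ SepTopAt 2`) and IS decided at `m₀ = 2` by THEOREM A (modulo `HeightComparison`). -/
theorem H17P_territory (hH : HeightComparison) : ¬ DecidedAt 2 H17P ∧ ¬ SepTopAt 2 H17P ∧ ThinFibreAt 2 H17P :=
  ⟨not_decidedAt_two_H17P, not_sepTopAt_H17P 2, thinFibreAt_two_H17P hH⟩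

/-! #### Two boundary / non-members (for the honest limits and the controls) -/

/-- the BOUNDARY member `B17P = Y² − 17x` (`deg_Y = 2 = 2 · xdeg`): NOT covered by THEOREM A or B at `m₀ = 2`. -/
def b17C : ℕ → ℤ[X] := fun j => if j = 1 then -Polynomial.C 17 else X ^ 2

/-- the BOUNDARY member `B17P = Y² − 17x` as an element of `ℤ[x][Y]` (`xPolyP 1 b17C`; `deg_Y = 2 = 2 · xdeg`). -/
def B17P : ℤ[X][X] := xPolyP 1 b17C

/-- `b17C 1 = -Polynomial.C 17`. -/
theorem b17C_one : b17C 1 = -Polynomial.C 17 := by simp [b17C]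
/-- `{j : ℕ} (hj : j ≠ 1) : b17C j = X ^ 2`. -/
theorem b17C_of_ne {j : ℕ} (hj : j ≠ 1) : b17C j = X ^ 2 := by simp [b17C, hj]
/-- `b17C 1 ≠ 0`. -/
theorem b17C_one_ne_zero : b17C 1 ≠ 0 := by
  rw [b17C_one, neg_ne_zero]; exact Polynomial.C_ne_zero.mpr (by norm_num)

/-- `xdeg B17P = 1`. -/
theorem xdeg_B17P : xdeg B17P = 1 := xdeg_xPolyP 1 b17C b17C_one_ne_zero

/-- `B17P.coeff 2 = 1`. -/
theorem coeff_B17P_two : B17P.coeff 2 = 1 := by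
  ext i
  rw [B17P, coeff_coeff_xPolyP, coeff_one]
  by_cases hi : i < 2
  · rw [if_pos (Finset.mem_range.mpr hi)]
    interval_cases i
    · rw [b17C_of_ne (by norm_num), coeff_X_pow]; simp
    · rw [b17C_one]; simp
  · rw [if_neg (by rw [Finset.mem_range]; exact hi), if_neg (by omega)]

/-- `B17P.natDegree = 2`. -/
theorem natDegree_B17P : B17P.natDegree = 2 := by
  refine le_antisymm (natDegree_xPolyP_le 1 b17C 2 fun j _ => ?_)
    (le_natDegree_of_ne_zero (by rw [coeff_B17P_two]; exact one_ne_zero))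
  by_cases hj : j = 1
  · subst hj; rw [b17C_one, natDegree_neg, natDegree_C]; norm_num
  · rw [b17C_of_ne hj, natDegree_X_pow]

/-- `B17P` sits ON the boundary `deg_Y = m₀ · xdeg` at `m₀ = 2`. -/
theorem boundary_B17P : B17P.natDegree = 2 * xdeg B17P := by rw [natDegree_B17P, xdeg_B17P]

/-- the NORM-FORM non-member `N2P = Y² − 2x²`: prime over `ℚ`, degrees inside the height class at `m₀ = 2`
(`2 < 2·2`), but NOT geometrically irreducible (`(Y − √2·x)(Y + √2·x)` over `ℚ̄`). -/
def n2C : ℕ → ℤ[X] := fun j => if j = 2 then -Polynomial.C 2 else if j = 1 then 0 else X ^ 2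

/-- the NORM-FORM non-member `N2P = Y² − 2x²` as an element of `ℤ[x][Y]` (`xPolyP 2 n2C`). -/
def N2P : ℤ[X][X] := xPolyP 2 n2C

/-- `n2C 2 = -Polynomial.C 2`. -/
theorem n2C_two : n2C 2 = -Polynomial.C 2 := by simp [n2C]
/-- `n2C 1 = 0`. -/
theorem n2C_one : n2C 1 = 0 := by simp [n2C]
/-- `n2C 0 = X ^ 2`. -/
theorem n2C_zero : n2C 0 = X ^ 2 := by simp [n2C]
/-- `{j : ℕ} (hj : 3 ≤ j) : n2C j = X ^ 2` (unused indices). -/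
theorem n2C_of_ge {j : ℕ} (hj : 3 ≤ j) : n2C j = X ^ 2 := by
  simp [n2C, show j ≠ 2 by omega, show j ≠ 1 by omega]
/-- `n2C 2 ≠ 0`. -/
theorem n2C_two_ne_zero : n2C 2 ≠ 0 := by
  rw [n2C_two, neg_ne_zero]; exact Polynomial.C_ne_zero.mpr (by norm_num)

/-- `xdeg N2P = 2`. -/
theorem xdeg_N2P : xdeg N2P = 2 := xdeg_xPolyP 2 n2C n2C_two_ne_zero

/-- the `Y`-coefficients of `N2P`: `−2x²`, `0`, `1`. -/
theorem coeff_N2P_zero : N2P.coeff 0 = -(Polynomial.C 2 * X ^ 2) := by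
  ext i
  rw [N2P, coeff_coeff_xPolyP]
  by_cases hi : i < 3
  · rw [if_pos (Finset.mem_range.mpr hi)]
    interval_cases i
    · rw [n2C_zero]; simp [coeff_X_pow]
    · rw [n2C_one]; simp [coeff_X_pow]
    · rw [n2C_two]; simp [coeff_X_pow]
  · rw [if_neg (by rw [Finset.mem_range]; exact hi)]; simp [coeff_X_pow]; omega

/-- `N2P.coeff 1 = 0`. -/
theorem coeff_N2P_one : N2P.coeff 1 = 0 := by
  ext i
  rw [N2P, coeff_coeff_xPolyP, coeff_zero]
  by_cases hi : i < 3
  · rw [if_pos (Finset.mem_range.mpr hi)]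
    interval_cases i
    · rw [n2C_zero, coeff_X_pow]; simp
    · rw [n2C_one, coeff_zero]
    · rw [n2C_two]; simp
  · rw [if_neg (by rw [Finset.mem_range]; exact hi)]

/-- `N2P.coeff 2 = 1`. -/
theorem coeff_N2P_two : N2P.coeff 2 = 1 := by
  ext i
  rw [N2P, coeff_coeff_xPolyP, coeff_one]
  by_cases hi : i < 3
  · rw [if_pos (Finset.mem_range.mpr hi)]
    interval_cases i
    · rw [n2C_zero, coeff_X_pow]; simp
    · rw [n2C_one, coeff_zero]; simp
    · rw [n2C_two]; simp
  · rw [if_neg (by rw [Finset.mem_range]; exact hi), if_neg (by omega)]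

/-- `N2P.natDegree = 2`. -/
theorem natDegree_N2P : N2P.natDegree = 2 := by
  refine le_antisymm (natDegree_xPolyP_le 2 n2C 2 fun j _ => ?_)
    (le_natDegree_of_ne_zero (by rw [coeff_N2P_two]; exact one_ne_zero))
  rcases Nat.lt_or_ge j 3 with hj | hj
  · interval_cases j
    · rw [n2C_zero, natDegree_X_pow]
    · rw [n2C_one, natDegree_zero]; norm_num
    · rw [n2C_two, natDegree_neg, natDegree_C]; norm_num
  · rw [n2C_of_ge hj, natDegree_X_pow]

/-- `N2P.Monic`. -/
theorem monic_N2P : N2P.Monic := by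
  rw [Monic, leadingCoeff, natDegree_N2P, coeff_N2P_two]

/-- the degrees of `N2P` are INSIDE the height class at `m₀ = 2` … -/
theorem degrees_N2P : N2P.natDegree < 2 * xdeg N2P := by rw [natDegree_N2P, xdeg_N2P]; norm_num

/-- … but **`N2P` is NOT geometrically irreducible** — PROVED (`Y = √2·x` is a root over `ℚ̄[x]`): the hypothesis
`GeomIrreducible` of THEOREM A is a genuine restriction. -/
theorem not_geomIrreducible_N2P : ¬ GeomIrreducible N2P := by
  unfold GeomIrreducible
  obtain ⟨s, hs⟩ := IsAlgClosed.exists_eq_mul_self (2 : AlgebraicClosure ℚ)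
  set Q : Polynomial (Polynomial (AlgebraicClosure ℚ)) :=
    N2P.map (mapRingHom (algebraMap ℤ (AlgebraicClosure ℚ))) with hQ
  have hmon : Q.Monic := monic_N2P.map _
  have hQdeg : Q.natDegree = 2 := by rw [hQ, monic_N2P.natDegree_map, natDegree_N2P]
  have hc0 : Q.coeff 0 = -(2 * X ^ 2) := by
    rw [hQ, coeff_map, coeff_N2P_zero]; simp
  have hc1 : Q.coeff 1 = 0 := by rw [hQ, coeff_map, coeff_N2P_one]; simp
  have hc2 : Q.coeff 2 = 1 := by rw [hQ, coeff_map, coeff_N2P_two]; simp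
  have hroot : Q.IsRoot (Polynomial.C s * X) := by
    rw [IsRoot, eval_eq_sum_range, hQdeg]
    simp only [Finset.sum_range_succ, Finset.sum_range_zero, hc0, hc1, hc2]
    have h2 : (2 : Polynomial (AlgebraicClosure ℚ)) = Polynomial.C s * Polynomial.C s := by
      rw [← Polynomial.C_mul, ← hs, map_ofNat]
    rw [h2]; ring
  intro hirr
  have hfac := (mul_divByMonic_eq_iff_isRoot (p := Q) (a := Polynomial.C s * X)).mpr hroot
  rcases hirr.isUnit_or_isUnit hfac.symm with hu | hu
  · exact not_isUnit_X_sub_C _ hu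
  · have h0 := natDegree_eq_zero_of_isUnit hu
    rw [natDegree_divByMonic _ (monic_X_sub_C _), hQdeg, natDegree_X_sub_C] at h0
    exact absurd h0 (by norm_num)

end Summit.Schanuel.Schanuel.Theorems.RootDecomp1KHeightGrading

end
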